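import Summits.CriticalPhenomena.PercolationContinuityZ3.Theorems.Transplant.FKConnectivityAllQAntipodalValueLevel3
import Summits.CriticalPhenomena.PercolationContinuityZ3.Theorems.Transplant.FKConnectivityAllQAntipodalCellThreshold
import HarnessLib

/-!
# Connectivity correlation inequalities for `φ_{w,q}`, every `q > 0` — file 45e: the four-edge THRESHOLD events at the VALUE LEVEL

Support file (`--supports stmt-CriticalPhenomena-4575`), FK sub-lane `prim-bschramm-fk-2` (gen 20); builds on p205010 (kernel theorem,
internal audit signed; external expert review pending).  No definitions, no named facts, no sorries; standard axioms.

* `FK.apPsiC_read4_absorb_nonpos_of_isTTSP` — a test function reading four pairs one of which is NOT live is, after absorption, a three-pair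
  function: file 45c applies;
* `FK.apPsiC_thr3of4_read_sub_nonpos_of_isTTSP`, `FK.apPsiC_thr2of4_read_sub_nonpos_of_isTTSP` — the thresholds `≥ 3 of 4`, `≥ 2 of 4` in ANY cell,
  the four pairs wherever they sit (all live: file 45d);
* **`FK.rcMeasureW_thr3of4_inter_le_of_isTTSP`**, **`FK.rcMeasureW_thr2of4_inter_le_of_isTTSP`** — under `φ_{w,q}` (`0 < q ≤ 1`, `w` on a 2-connected
  series–parallel graph) the events `{≥ 3 of the edges x,y,z,w open}` and `{≥ 2 of them open}` are negatively correlated with every increasing event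
  reading none of `x, y, z, w` (with `{≥ 1}` = OR and `{= 4}` = AND from gen 19, all four-edge threshold events).
[cite: Grimmett2006, §1.4 eq. (1.20) (p. 15); §3.8 Thm. (3.90) (pp. 61–62); §3.9 (pp. 63–64)] [cite: Wagner2006, Thm. 5.8(d), §5.3]
-/

noncomputable section

namespace Summit.CriticalPhenomena.PercolationContinuityZ3.Theorems

namespace FK

open MeasureTheory Literature.Probability.LatticeModels Literature.Probability.Percolation
open Literature.Probability.Percolation.DecisionTree (ind ind_of_mem ind_of_not_mem)
open scoped Classical

universe u

variable {V : Type u} [Fintype V] {s t : V}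

/-- **Four read pairs, one not live**: absorb it and apply the three-pair theorem. [folklore] -/
theorem apPsiC_read4_absorb_nonpos_of_isTTSP {q : ℝ} (hq0 : 0 < q) (hq1 : q ≤ 1) {E : Finset (Sym2 V)} (hE : IsTTSP E s t)
    (hst : s(s, t) ∉ E) {M C : Finset (Sym2 V)} (hM : M ⊆ insert s(s, t) E) (hC : C ⊆ insert s(s, t) E) (hMC : Disjoint M C)
    {x y z w : Sym2 V} (hxy : x ≠ y) (hxz : x ≠ z) (hyz : y ≠ z) (hwM : w ∉ M) {f g : Finset (Sym2 V) → ℝ}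
    (hf : ∀ e : Sym2 V, e ∉ ({x, y, z, w} : Finset (Sym2 V)) → ∀ A : Finset (Sym2 V), f (insert e A) = f A)
    (hfmono : ∀ ⦃A B : Finset (Sym2 V)⦄, A ⊆ B → f A ≤ f B)
    (hgx : ∀ A : Finset (Sym2 V), g (insert x A) = g A) (hgy : ∀ A : Finset (Sym2 V), g (insert y A) = g A)
    (hgz : ∀ A : Finset (Sym2 V), g (insert z A) = g A) (hgC : ∀ e ∈ C, ∀ A : Finset (Sym2 V), g (insert e A) = g A)
    (hmono : ∀ ⦃A B : Finset (Sym2 V)⦄, A ⊆ B → B ⊆ M → g A ≤ g B) :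
    apPsiC q M C f g ≤ 0 := by
  rw [apPsiC_absorb q hwM f g]
  have hsub : ({x, y, z, w} : Finset (Sym2 V)).erase w ⊆ {x, y, z} := fun e he => by
    have h := Finset.mem_erase.1 he
    simp only [Finset.mem_insert, Finset.mem_singleton] at h ⊢
    tauto
  exact apPsiC_read3_sub_nonpos_of_isTTSP hq0 hq1 hE hst hM hC hMC hxy hxz hyz
    (notRead_of_subset (f := fun X => f (if w ∈ C then insert w X else X.erase w)) hsub
      (absorb_notRead (R := ({x, y, z, w} : Finset (Sym2 V))) (C := C) (e := w) hf))
    (absorb_mono (C := C) (e := w) hfmono) hgx hgy hgz hgC hmono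

omit [Fintype V] in
/-- The `≥ 3 of 4` indicator reads only its four pairs. [folklore] -/
theorem thr3of4_notRead (x y z w : Sym2 V) :
    ∀ e : Sym2 V, e ∉ ({x, y, z, w} : Finset (Sym2 V)) → ∀ A : Finset (Sym2 V),
      (fun A : Finset (Sym2 V) => if (x ∈ A ∧ y ∈ A ∧ z ∈ A) ∨ (x ∈ A ∧ y ∈ A ∧ w ∈ A) ∨ (x ∈ A ∧ z ∈ A ∧ w ∈ A) ∨
        (y ∈ A ∧ z ∈ A ∧ w ∈ A) then (1 : ℝ) else 0) (insert e A) =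
      (fun A : Finset (Sym2 V) => if (x ∈ A ∧ y ∈ A ∧ z ∈ A) ∨ (x ∈ A ∧ y ∈ A ∧ w ∈ A) ∨ (x ∈ A ∧ z ∈ A ∧ w ∈ A) ∨
        (y ∈ A ∧ z ∈ A ∧ w ∈ A) then (1 : ℝ) else 0) A := by
  intro e he A
  have hex : x ≠ e := fun h => he (h ▸ by simp)
  have hey : y ≠ e := fun h => he (h ▸ by simp)
  have hez : z ≠ e := fun h => he (h ▸ by simp)
  have hew : w ≠ e := fun h => he (h ▸ by simp)
  simp only [Finset.mem_insert, hex, hey, hez, hew, false_or]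

omit [Fintype V] in
/-- The `≥ 3 of 4` indicator is increasing. [folklore] -/
theorem thr3of4_mono (x y z w : Sym2 V) : ∀ ⦃A B : Finset (Sym2 V)⦄, A ⊆ B →
    (fun A : Finset (Sym2 V) => if (x ∈ A ∧ y ∈ A ∧ z ∈ A) ∨ (x ∈ A ∧ y ∈ A ∧ w ∈ A) ∨ (x ∈ A ∧ z ∈ A ∧ w ∈ A) ∨
        (y ∈ A ∧ z ∈ A ∧ w ∈ A) then (1 : ℝ) else 0) A ≤
      (fun A : Finset (Sym2 V) => if (x ∈ A ∧ y ∈ A ∧ z ∈ A) ∨ (x ∈ A ∧ y ∈ A ∧ w ∈ A) ∨ (x ∈ A ∧ z ∈ A ∧ w ∈ A) ∨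
        (y ∈ A ∧ z ∈ A ∧ w ∈ A) then (1 : ℝ) else 0) B := by
  intro A B hAB
  dsimp only
  by_cases hB : (x ∈ B ∧ y ∈ B ∧ z ∈ B) ∨ (x ∈ B ∧ y ∈ B ∧ w ∈ B) ∨ (x ∈ B ∧ z ∈ B ∧ w ∈ B) ∨ (y ∈ B ∧ z ∈ B ∧ w ∈ B)
  · rw [if_pos hB]; split_ifs <;> norm_num
  · have hA : ¬ ((x ∈ A ∧ y ∈ A ∧ z ∈ A) ∨ (x ∈ A ∧ y ∈ A ∧ w ∈ A) ∨ (x ∈ A ∧ z ∈ A ∧ w ∈ A) ∨ (y ∈ A ∧ z ∈ A ∧ w ∈ A)) := by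
      intro h; apply hB
      rcases h with ⟨h1, h2, h3⟩ | ⟨h1, h2, h3⟩ | ⟨h1, h2, h3⟩ | ⟨h1, h2, h3⟩
      · exact Or.inl ⟨hAB h1, hAB h2, hAB h3⟩
      · exact Or.inr (Or.inl ⟨hAB h1, hAB h2, hAB h3⟩)
      · exact Or.inr (Or.inr (Or.inl ⟨hAB h1, hAB h2, hAB h3⟩))
      · exact Or.inr (Or.inr (Or.inr ⟨hAB h1, hAB h2, hAB h3⟩))
    rw [if_neg hA, if_neg hB]

omit [Fintype V] in
/-- Cyclic relabelling of the `≥ 3 of 4` indicator. [folklore] -/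
theorem thr3of4_rotate (x y z w : Sym2 V) :
    (fun A : Finset (Sym2 V) => if (x ∈ A ∧ y ∈ A ∧ z ∈ A) ∨ (x ∈ A ∧ y ∈ A ∧ w ∈ A) ∨ (x ∈ A ∧ z ∈ A ∧ w ∈ A) ∨
        (y ∈ A ∧ z ∈ A ∧ w ∈ A) then (1 : ℝ) else 0) =
      fun A : Finset (Sym2 V) => if (y ∈ A ∧ z ∈ A ∧ w ∈ A) ∨ (y ∈ A ∧ z ∈ A ∧ x ∈ A) ∨ (y ∈ A ∧ w ∈ A ∧ x ∈ A) ∨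
        (z ∈ A ∧ w ∈ A ∧ x ∈ A) then (1 : ℝ) else 0 := by
  funext A
  have hiff : ((x ∈ A ∧ y ∈ A ∧ z ∈ A) ∨ (x ∈ A ∧ y ∈ A ∧ w ∈ A) ∨ (x ∈ A ∧ z ∈ A ∧ w ∈ A) ∨ (y ∈ A ∧ z ∈ A ∧ w ∈ A)) ↔
      ((y ∈ A ∧ z ∈ A ∧ w ∈ A) ∨ (y ∈ A ∧ z ∈ A ∧ x ∈ A) ∨ (y ∈ A ∧ w ∈ A ∧ x ∈ A) ∨ (z ∈ A ∧ w ∈ A ∧ x ∈ A)) := by tauto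
  simp only [hiff]

/-- **`≥ 3 of 4` in any cell, the four pairs wherever they sit** (`0 < q ≤ 1`). [cite: Grimmett2006, §3.8 Thm. (3.90) (pp. 61–62); §3.9 (pp. 63–64)] -/
theorem apPsiC_thr3of4_read_sub_nonpos_of_isTTSP {q : ℝ} (hq0 : 0 < q) (hq1 : q ≤ 1) {E : Finset (Sym2 V)} (hE : IsTTSP E s t)
    (hst : s(s, t) ∉ E) {M C : Finset (Sym2 V)} (hM : M ⊆ insert s(s, t) E) (hC : C ⊆ insert s(s, t) E) (hMC : Disjoint M C)
    {x y z w : Sym2 V} (hxy : x ≠ y) (hxz : x ≠ z) (hxw : x ≠ w) (hyz : y ≠ z) (hyw : y ≠ w) (hzw : z ≠ w)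
    {g : Finset (Sym2 V) → ℝ}
    (hgx : ∀ A : Finset (Sym2 V), g (insert x A) = g A) (hgy : ∀ A : Finset (Sym2 V), g (insert y A) = g A)
    (hgz : ∀ A : Finset (Sym2 V), g (insert z A) = g A) (hgw : ∀ A : Finset (Sym2 V), g (insert w A) = g A)
    (hgC : ∀ e ∈ C, ∀ A : Finset (Sym2 V), g (insert e A) = g A)
    (hmono : ∀ ⦃A B : Finset (Sym2 V)⦄, A ⊆ B → B ⊆ M → g A ≤ g B) :
    apPsiC q M C (fun A => if (x ∈ A ∧ y ∈ A ∧ z ∈ A) ∨ (x ∈ A ∧ y ∈ A ∧ w ∈ A) ∨ (x ∈ A ∧ z ∈ A ∧ w ∈ A) ∨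
        (y ∈ A ∧ z ∈ A ∧ w ∈ A) then 1 else 0) g ≤ 0 := by
  by_cases hwM : w ∈ M
  · by_cases hzM : z ∈ M
    · by_cases hyM : y ∈ M
      · by_cases hxM : x ∈ M
        · exact apPsiC_thr3of4_sub_nonpos_of_isTTSP hq0 hq1 hE hst hM hC hMC hxM hyM hzM hwM hxy hxz hxw hyz hyw hzw hgx hgy hgz hgw
            hgC hmono
        · -- x not live: rotate so that x comes last
          rw [thr3of4_rotate]
          have hset : ({y, z, w, x} : Finset (Sym2 V)) = {x, y, z, w} := by
            ext e; simp only [Finset.mem_insert, Finset.mem_singleton]; tauto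
          exact apPsiC_read4_absorb_nonpos_of_isTTSP hq0 hq1 hE hst hM hC hMC hyz hyw hzw hxM
            (hset ▸ thr3of4_notRead y z w x) (thr3of4_mono y z w x) hgy hgz hgw hgC hmono
      · rw [thr3of4_rotate, thr3of4_rotate]
        exact apPsiC_read4_absorb_nonpos_of_isTTSP hq0 hq1 hE hst hM hC hMC hzw hxz.symm hxw.symm hyM
          (thr3of4_notRead z w x y) (thr3of4_mono z w x y) hgz hgw hgx hgC hmono
    · rw [thr3of4_rotate, thr3of4_rotate, thr3of4_rotate]
      exact apPsiC_read4_absorb_nonpos_of_isTTSP hq0 hq1 hE hst hM hC hMC hxw.symm hyw.symm hxy hzM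
        (thr3of4_notRead w x y z) (thr3of4_mono w x y z) hgw hgx hgy hgC hmono
  · exact apPsiC_read4_absorb_nonpos_of_isTTSP hq0 hq1 hE hst hM hC hMC hxy hxz hyz hwM
      (thr3of4_notRead x y z w) (thr3of4_mono x y z w) hgx hgy hgz hgC hmono

/-- **`≥ 3 OF 4`, VALUE LEVEL** (`0 < q ≤ 1`): under `φ_{w,q}` on a weighted 2-connected series–parallel graph, `{≥ 3 of x,y,z,w open}` is negatively
correlated with every increasing event reading none of `x, y, z, w`. [cite: Grimmett2006, §3.8 Thm. (3.90) (pp. 61–62); §3.9 (pp. 63–64)] -/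
theorem rcMeasureW_thr3of4_inter_le_of_isTTSP {q : ℝ} (hq0 : 0 < q) (hq1 : q ≤ 1) {E : Finset (Sym2 V)} (hE : IsTTSP E s t)
    (hst : s(s, t) ∉ E) (wt : Sym2 V → unitInterval) (hw : ∀ e, e ∉ insert s(s, t) E → ((wt e : ℝ)) = 0)
    {x y z w : Sym2 V} (hxy : x ≠ y) (hxz : x ≠ z) (hxw : x ≠ w) (hyz : y ≠ z) (hyw : y ≠ w) (hzw : z ≠ w)
    (B : Set (BondConfig V))
    (hBx : ∀ ω : BondConfig V, insert x ω ∈ B ↔ ω ∈ B) (hBy : ∀ ω : BondConfig V, insert y ω ∈ B ↔ ω ∈ B)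
    (hBz : ∀ ω : BondConfig V, insert z ω ∈ B ↔ ω ∈ B) (hBw : ∀ ω : BondConfig V, insert w ω ∈ B ↔ ω ∈ B)
    (hBmono : ∀ ω ω' : BondConfig V, ω ⊆ ω' → ω ∈ B → ω' ∈ B) :
    (rcMeasureW wt q ∅).real ({ω : BondConfig V | (x ∈ ω ∧ y ∈ ω ∧ z ∈ ω) ∨ (x ∈ ω ∧ y ∈ ω ∧ w ∈ ω) ∨ (x ∈ ω ∧ z ∈ ω ∧ w ∈ ω) ∨
        (y ∈ ω ∧ z ∈ ω ∧ w ∈ ω)} ∩ B) ≤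
      (rcMeasureW wt q ∅).real {ω : BondConfig V | (x ∈ ω ∧ y ∈ ω ∧ z ∈ ω) ∨ (x ∈ ω ∧ y ∈ ω ∧ w ∈ ω) ∨ (x ∈ ω ∧ z ∈ ω ∧ w ∈ ω) ∨
        (y ∈ ω ∧ z ∈ ω ∧ w ∈ ω)} * (rcMeasureW wt q ∅).real B := by
  set A : Set (BondConfig V) := {ω : BondConfig V | (x ∈ ω ∧ y ∈ ω ∧ z ∈ ω) ∨ (x ∈ ω ∧ y ∈ ω ∧ w ∈ ω) ∨
    (x ∈ ω ∧ z ∈ ω ∧ w ∈ ω) ∨ (y ∈ ω ∧ z ∈ ω ∧ w ∈ ω)} with hAdef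
  refine rcMeasureW_real_inter_le_of_apPsiC_nonpos_on hq0 wt (insert s(s, t) E) hw A B fun σ S hSσ hσ hS => ?_
  have hSσd : Disjoint S σ := Finset.disjoint_of_subset_left hSσ Finset.sdiff_disjoint
  have indI : ∀ (X : Set (BondConfig V)) (e : Sym2 V) (P : Finset (Sym2 V)),
      (insert e (↑P : BondConfig V) ∈ X ↔ (↑P : BondConfig V) ∈ X) → ind X (↑(insert e P) : BondConfig V) = ind X ↑P := by
    intro X e P h
    rw [Finset.coe_insert]
    by_cases hP : (↑P : BondConfig V) ∈ X
    · rw [ind_of_mem hP, ind_of_mem (h.2 hP)]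
    · rw [ind_of_not_mem hP, ind_of_not_mem (fun h' => hP (h.1 h'))]
  -- the indicator of A on finite configurations is the threshold indicator
  have hfun : (fun γ : Finset (Sym2 V) => ind A (↑γ : BondConfig V)) =
      fun A' : Finset (Sym2 V) => if (x ∈ A' ∧ y ∈ A' ∧ z ∈ A') ∨ (x ∈ A' ∧ y ∈ A' ∧ w ∈ A') ∨ (x ∈ A' ∧ z ∈ A' ∧ w ∈ A') ∨
        (y ∈ A' ∧ z ∈ A' ∧ w ∈ A') then (1 : ℝ) else 0 := by
    funext γ
    unfold ind
    simp only [hAdef, Set.mem_setOf_eq, Finset.mem_coe]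
  rw [hfun, apPsiC_right_union]
  refine apPsiC_thr3of4_read_sub_nonpos_of_isTTSP hq0 hq1 hE hst hS hσ hSσd hxy hxz hxw hyz hyw hzw
    (fun P => ?_) (fun P => ?_) (fun P => ?_) (fun P => ?_) (fun e he P => ?_)
    (fun P Q hPQ _ => ?_)
  · show ind B ↑(insert x P ∪ σ) = ind B ↑(P ∪ σ)
    rw [Finset.insert_union]; exact indI B x _ (hBx _)
  · show ind B ↑(insert y P ∪ σ) = ind B ↑(P ∪ σ)
    rw [Finset.insert_union]; exact indI B y _ (hBy _)
  · show ind B ↑(insert z P ∪ σ) = ind B ↑(P ∪ σ)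
    rw [Finset.insert_union]; exact indI B z _ (hBz _)
  · show ind B ↑(insert w P ∪ σ) = ind B ↑(P ∪ σ)
    rw [Finset.insert_union]; exact indI B w _ (hBw _)
  · show ind B ↑(insert e P ∪ σ) = ind B ↑(P ∪ σ)
    rw [Finset.insert_union, Finset.insert_eq_of_mem (Finset.mem_union_right _ he)]
  · show ind B ↑(P ∪ σ) ≤ ind B ↑(Q ∪ σ)
    have hPQ' : (↑(P ∪ σ) : BondConfig V) ⊆ ↑(Q ∪ σ) := Finset.coe_subset.2 (Finset.union_subset_union hPQ le_rfl)
    by_cases hP : (↑(P ∪ σ) : BondConfig V) ∈ B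
    · rw [ind_of_mem hP, ind_of_mem (hBmono _ _ hPQ' hP)]
    · rw [ind_of_not_mem hP]
      by_cases hQ : (↑(Q ∪ σ) : BondConfig V) ∈ B
      · rw [ind_of_mem hQ]; exact zero_le_one
      · rw [ind_of_not_mem hQ]

omit [Fintype V] in
/-- The `≥ 2 of 4` indicator reads only its four pairs. [folklore] -/
theorem thr2of4_notRead (x y z w : Sym2 V) :
    ∀ e : Sym2 V, e ∉ ({x, y, z, w} : Finset (Sym2 V)) → ∀ A : Finset (Sym2 V),
      (fun A : Finset (Sym2 V) => if (x ∈ A ∧ y ∈ A) ∨ (x ∈ A ∧ z ∈ A) ∨ (x ∈ A ∧ w ∈ A) ∨ (y ∈ A ∧ z ∈ A) ∨ (y ∈ A ∧ w ∈ A) ∨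
        (z ∈ A ∧ w ∈ A) then (1 : ℝ) else 0) (insert e A) =
      (fun A : Finset (Sym2 V) => if (x ∈ A ∧ y ∈ A) ∨ (x ∈ A ∧ z ∈ A) ∨ (x ∈ A ∧ w ∈ A) ∨ (y ∈ A ∧ z ∈ A) ∨ (y ∈ A ∧ w ∈ A) ∨
        (z ∈ A ∧ w ∈ A) then (1 : ℝ) else 0) A := by
  intro e he A
  have hex : x ≠ e := fun h => he (h ▸ by simp)
  have hey : y ≠ e := fun h => he (h ▸ by simp)
  have hez : z ≠ e := fun h => he (h ▸ by simp)
  have hew : w ≠ e := fun h => he (h ▸ by simp)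
  simp only [Finset.mem_insert, hex, hey, hez, hew, false_or]

omit [Fintype V] in
/-- The `≥ 2 of 4` indicator is increasing. [folklore] -/
theorem thr2of4_mono (x y z w : Sym2 V) : ∀ ⦃A B : Finset (Sym2 V)⦄, A ⊆ B →
    (fun A : Finset (Sym2 V) => if (x ∈ A ∧ y ∈ A) ∨ (x ∈ A ∧ z ∈ A) ∨ (x ∈ A ∧ w ∈ A) ∨ (y ∈ A ∧ z ∈ A) ∨ (y ∈ A ∧ w ∈ A) ∨
        (z ∈ A ∧ w ∈ A) then (1 : ℝ) else 0) A ≤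
      (fun A : Finset (Sym2 V) => if (x ∈ A ∧ y ∈ A) ∨ (x ∈ A ∧ z ∈ A) ∨ (x ∈ A ∧ w ∈ A) ∨ (y ∈ A ∧ z ∈ A) ∨ (y ∈ A ∧ w ∈ A) ∨
        (z ∈ A ∧ w ∈ A) then (1 : ℝ) else 0) B := by
  intro A B hAB
  dsimp only
  by_cases hB : (x ∈ B ∧ y ∈ B) ∨ (x ∈ B ∧ z ∈ B) ∨ (x ∈ B ∧ w ∈ B) ∨ (y ∈ B ∧ z ∈ B) ∨ (y ∈ B ∧ w ∈ B) ∨ (z ∈ B ∧ w ∈ B)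
  · rw [if_pos hB]; split_ifs <;> norm_num
  · have hA : ¬ ((x ∈ A ∧ y ∈ A) ∨ (x ∈ A ∧ z ∈ A) ∨ (x ∈ A ∧ w ∈ A) ∨ (y ∈ A ∧ z ∈ A) ∨ (y ∈ A ∧ w ∈ A) ∨ (z ∈ A ∧ w ∈ A)) := by
      intro h; apply hB
      rcases h with ⟨h1, h2⟩ | ⟨h1, h2⟩ | ⟨h1, h2⟩ | ⟨h1, h2⟩ | ⟨h1, h2⟩ | ⟨h1, h2⟩
      · exact Or.inl ⟨hAB h1, hAB h2⟩
      · exact Or.inr (Or.inl ⟨hAB h1, hAB h2⟩)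
      · exact Or.inr (Or.inr (Or.inl ⟨hAB h1, hAB h2⟩))
      · exact Or.inr (Or.inr (Or.inr (Or.inl ⟨hAB h1, hAB h2⟩)))
      · exact Or.inr (Or.inr (Or.inr (Or.inr (Or.inl ⟨hAB h1, hAB h2⟩))))
      · exact Or.inr (Or.inr (Or.inr (Or.inr (Or.inr ⟨hAB h1, hAB h2⟩))))
    rw [if_neg hA, if_neg hB]

omit [Fintype V] in
/-- Cyclic relabelling of the `≥ 2 of 4` indicator. [folklore] -/
theorem thr2of4_rotate (x y z w : Sym2 V) :
    (fun A : Finset (Sym2 V) => if (x ∈ A ∧ y ∈ A) ∨ (x ∈ A ∧ z ∈ A) ∨ (x ∈ A ∧ w ∈ A) ∨ (y ∈ A ∧ z ∈ A) ∨ (y ∈ A ∧ w ∈ A) ∨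
        (z ∈ A ∧ w ∈ A) then (1 : ℝ) else 0) =
      fun A : Finset (Sym2 V) => if (y ∈ A ∧ z ∈ A) ∨ (y ∈ A ∧ w ∈ A) ∨ (y ∈ A ∧ x ∈ A) ∨ (z ∈ A ∧ w ∈ A) ∨ (z ∈ A ∧ x ∈ A) ∨
        (w ∈ A ∧ x ∈ A) then (1 : ℝ) else 0 := by
  funext A
  have hiff : ((x ∈ A ∧ y ∈ A) ∨ (x ∈ A ∧ z ∈ A) ∨ (x ∈ A ∧ w ∈ A) ∨ (y ∈ A ∧ z ∈ A) ∨ (y ∈ A ∧ w ∈ A) ∨ (z ∈ A ∧ w ∈ A)) ↔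
      ((y ∈ A ∧ z ∈ A) ∨ (y ∈ A ∧ w ∈ A) ∨ (y ∈ A ∧ x ∈ A) ∨ (z ∈ A ∧ w ∈ A) ∨ (z ∈ A ∧ x ∈ A) ∨ (w ∈ A ∧ x ∈ A)) := by tauto
  simp only [hiff]

/-- **`≥ 2 of 4` in any cell, the four pairs wherever they sit** (`0 < q ≤ 1`). [cite: Grimmett2006, §3.8 Thm. (3.90) (pp. 61–62); §3.9 (pp. 63–64)] -/
theorem apPsiC_thr2of4_read_sub_nonpos_of_isTTSP {q : ℝ} (hq0 : 0 < q) (hq1 : q ≤ 1) {E : Finset (Sym2 V)} (hE : IsTTSP E s t)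
    (hst : s(s, t) ∉ E) {M C : Finset (Sym2 V)} (hM : M ⊆ insert s(s, t) E) (hC : C ⊆ insert s(s, t) E) (hMC : Disjoint M C)
    {x y z w : Sym2 V} (hxy : x ≠ y) (hxz : x ≠ z) (hxw : x ≠ w) (hyz : y ≠ z) (hyw : y ≠ w) (hzw : z ≠ w)
    {g : Finset (Sym2 V) → ℝ}
    (hgx : ∀ A : Finset (Sym2 V), g (insert x A) = g A) (hgy : ∀ A : Finset (Sym2 V), g (insert y A) = g A)
    (hgz : ∀ A : Finset (Sym2 V), g (insert z A) = g A) (hgw : ∀ A : Finset (Sym2 V), g (insert w A) = g A)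
    (hgC : ∀ e ∈ C, ∀ A : Finset (Sym2 V), g (insert e A) = g A)
    (hmono : ∀ ⦃A B : Finset (Sym2 V)⦄, A ⊆ B → B ⊆ M → g A ≤ g B) :
    apPsiC q M C (fun A => if (x ∈ A ∧ y ∈ A) ∨ (x ∈ A ∧ z ∈ A) ∨ (x ∈ A ∧ w ∈ A) ∨ (y ∈ A ∧ z ∈ A) ∨ (y ∈ A ∧ w ∈ A) ∨
        (z ∈ A ∧ w ∈ A) then 1 else 0) g ≤ 0 := by
  by_cases hwM : w ∈ M
  · by_cases hzM : z ∈ M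
    · by_cases hyM : y ∈ M
      · by_cases hxM : x ∈ M
        · exact apPsiC_thr2of4_sub_nonpos_of_isTTSP hq0 hq1 hE hst hM hC hMC hxM hyM hzM hwM hxy hxz hxw hyz hyw hzw hgx hgy hgz hgw
            hgC hmono
        · rw [thr2of4_rotate]
          have hset : ({y, z, w, x} : Finset (Sym2 V)) = {x, y, z, w} := by
            ext e; simp only [Finset.mem_insert, Finset.mem_singleton]; tauto
          exact apPsiC_read4_absorb_nonpos_of_isTTSP hq0 hq1 hE hst hM hC hMC hyz hyw hzw hxM
            (hset ▸ thr2of4_notRead y z w x) (thr2of4_mono y z w x) hgy hgz hgw hgC hmono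
      · rw [thr2of4_rotate, thr2of4_rotate]
        exact apPsiC_read4_absorb_nonpos_of_isTTSP hq0 hq1 hE hst hM hC hMC hzw hxz.symm hxw.symm hyM
          (thr2of4_notRead z w x y) (thr2of4_mono z w x y) hgz hgw hgx hgC hmono
    · rw [thr2of4_rotate, thr2of4_rotate, thr2of4_rotate]
      exact apPsiC_read4_absorb_nonpos_of_isTTSP hq0 hq1 hE hst hM hC hMC hxw.symm hyw.symm hxy hzM
        (thr2of4_notRead w x y z) (thr2of4_mono w x y z) hgw hgx hgy hgC hmono
  · exact apPsiC_read4_absorb_nonpos_of_isTTSP hq0 hq1 hE hst hM hC hMC hxy hxz hyz hwM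
      (thr2of4_notRead x y z w) (thr2of4_mono x y z w) hgx hgy hgz hgC hmono

/-- **`≥ 2 OF 4`, VALUE LEVEL** (`0 < q ≤ 1`): under `φ_{w,q}` on a weighted 2-connected series–parallel graph, `{≥ 2 of x,y,z,w open}` is negatively
correlated with every increasing event reading none of `x, y, z, w`. [cite: Grimmett2006, §3.8 Thm. (3.90) (pp. 61–62); §3.9 (pp. 63–64)] -/
theorem rcMeasureW_thr2of4_inter_le_of_isTTSP {q : ℝ} (hq0 : 0 < q) (hq1 : q ≤ 1) {E : Finset (Sym2 V)} (hE : IsTTSP E s t)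
    (hst : s(s, t) ∉ E) (wt : Sym2 V → unitInterval) (hw : ∀ e, e ∉ insert s(s, t) E → ((wt e : ℝ)) = 0)
    {x y z w : Sym2 V} (hxy : x ≠ y) (hxz : x ≠ z) (hxw : x ≠ w) (hyz : y ≠ z) (hyw : y ≠ w) (hzw : z ≠ w)
    (B : Set (BondConfig V))
    (hBx : ∀ ω : BondConfig V, insert x ω ∈ B ↔ ω ∈ B) (hBy : ∀ ω : BondConfig V, insert y ω ∈ B ↔ ω ∈ B)
    (hBz : ∀ ω : BondConfig V, insert z ω ∈ B ↔ ω ∈ B) (hBw : ∀ ω : BondConfig V, insert w ω ∈ B ↔ ω ∈ B)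
    (hBmono : ∀ ω ω' : BondConfig V, ω ⊆ ω' → ω ∈ B → ω' ∈ B) :
    (rcMeasureW wt q ∅).real ({ω : BondConfig V | (x ∈ ω ∧ y ∈ ω) ∨ (x ∈ ω ∧ z ∈ ω) ∨ (x ∈ ω ∧ w ∈ ω) ∨ (y ∈ ω ∧ z ∈ ω) ∨
        (y ∈ ω ∧ w ∈ ω) ∨ (z ∈ ω ∧ w ∈ ω)} ∩ B) ≤
      (rcMeasureW wt q ∅).real {ω : BondConfig V | (x ∈ ω ∧ y ∈ ω) ∨ (x ∈ ω ∧ z ∈ ω) ∨ (x ∈ ω ∧ w ∈ ω) ∨ (y ∈ ω ∧ z ∈ ω) ∨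
        (y ∈ ω ∧ w ∈ ω) ∨ (z ∈ ω ∧ w ∈ ω)} * (rcMeasureW wt q ∅).real B := by
  set A : Set (BondConfig V) := {ω : BondConfig V | (x ∈ ω ∧ y ∈ ω) ∨ (x ∈ ω ∧ z ∈ ω) ∨ (x ∈ ω ∧ w ∈ ω) ∨ (y ∈ ω ∧ z ∈ ω) ∨
    (y ∈ ω ∧ w ∈ ω) ∨ (z ∈ ω ∧ w ∈ ω)} with hAdef
  refine rcMeasureW_real_inter_le_of_apPsiC_nonpos_on hq0 wt (insert s(s, t) E) hw A B fun σ S hSσ hσ hS => ?_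
  have hSσd : Disjoint S σ := Finset.disjoint_of_subset_left hSσ Finset.sdiff_disjoint
  have indI : ∀ (X : Set (BondConfig V)) (e : Sym2 V) (P : Finset (Sym2 V)),
      (insert e (↑P : BondConfig V) ∈ X ↔ (↑P : BondConfig V) ∈ X) → ind X (↑(insert e P) : BondConfig V) = ind X ↑P := by
    intro X e P h
    rw [Finset.coe_insert]
    by_cases hP : (↑P : BondConfig V) ∈ X
    · rw [ind_of_mem hP, ind_of_mem (h.2 hP)]
    · rw [ind_of_not_mem hP, ind_of_not_mem (fun h' => hP (h.1 h'))]
  have hfun : (fun γ : Finset (Sym2 V) => ind A (↑γ : BondConfig V)) =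
      fun A' : Finset (Sym2 V) => if (x ∈ A' ∧ y ∈ A') ∨ (x ∈ A' ∧ z ∈ A') ∨ (x ∈ A' ∧ w ∈ A') ∨ (y ∈ A' ∧ z ∈ A') ∨
        (y ∈ A' ∧ w ∈ A') ∨ (z ∈ A' ∧ w ∈ A') then (1 : ℝ) else 0 := by
    funext γ
    unfold ind
    simp only [hAdef, Set.mem_setOf_eq, Finset.mem_coe]
  rw [hfun, apPsiC_right_union]
  refine apPsiC_thr2of4_read_sub_nonpos_of_isTTSP hq0 hq1 hE hst hS hσ hSσd hxy hxz hxw hyz hyw hzw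
    (fun P => ?_) (fun P => ?_) (fun P => ?_) (fun P => ?_) (fun e he P => ?_)
    (fun P Q hPQ _ => ?_)
  · show ind B ↑(insert x P ∪ σ) = ind B ↑(P ∪ σ)
    rw [Finset.insert_union]; exact indI B x _ (hBx _)
  · show ind B ↑(insert y P ∪ σ) = ind B ↑(P ∪ σ)
    rw [Finset.insert_union]; exact indI B y _ (hBy _)
  · show ind B ↑(insert z P ∪ σ) = ind B ↑(P ∪ σ)
    rw [Finset.insert_union]; exact indI B z _ (hBz _)
  · show ind B ↑(insert w P ∪ σ) = ind B ↑(P ∪ σ)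
    rw [Finset.insert_union]; exact indI B w _ (hBw _)
  · show ind B ↑(insert e P ∪ σ) = ind B ↑(P ∪ σ)
    rw [Finset.insert_union, Finset.insert_eq_of_mem (Finset.mem_union_right _ he)]
  · show ind B ↑(P ∪ σ) ≤ ind B ↑(Q ∪ σ)
    have hPQ' : (↑(P ∪ σ) : BondConfig V) ⊆ ↑(Q ∪ σ) := Finset.coe_subset.2 (Finset.union_subset_union hPQ le_rfl)
    by_cases hP : (↑(P ∪ σ) : BondConfig V) ∈ B
    · rw [ind_of_mem hP, ind_of_mem (hBmono _ _ hPQ' hP)]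
    · rw [ind_of_not_mem hP]
      by_cases hQ : (↑(Q ∪ σ) : BondConfig V) ∈ B
      · rw [ind_of_mem hQ]; exact zero_le_one
      · rw [ind_of_not_mem hQ]

end FK

end Summit.CriticalPhenomena.PercolationContinuityZ3.Theorems

end
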